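import Literature.Analysis.Complex.BochnerArgRegion
import HarnessLib

/-!
# Explicit (family-uniform) bounds for the tube / argument-region continuations

Analysis/Complex support file (everything proved; no definitions, no named facts), sequel of
`BochnerTubeGrowth` and `BochnerArgRegion`. The bounds on the holomorphic continuations provided
there are existential (a constant depending on the function). Along the Osterwalder–Schrader
induction the Schwinger functions carry the spatial variables `ξ⃗` as parameters (OS II, Ch. V.2,
p. 294: "the spatial variables will always play the role of parameters … Continuity with respect
to them will be evident at each step"), and joint continuity at the end (Vitali) needs bounds that
are **uniform in the parameters**. This file gives versions of the maximum principle with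
**explicit constants** — functions of the input bound only — for functions already holomorphic on
the tube over the hull:

* `norm_le_on_tube_convexHull_of_norm_le` — the sharp maximum principle for a function holomorphic
  on `T(conv B)`: `‖F‖ ≤ M` on `T(B)` ⇒ `‖F‖ ≤ M` on `T(conv B)` (OS II (6.15)).
* `norm_cosh_prod_ge`, `norm_cosh_prod_le` — the two-sided bounds for the damping factor
  `E(w) = ∏ cosh(c wᵢ)^M`.
* `norm_le_explicit_of_expGrowth` — `‖F(x+iy)‖ ≤ C e^{a‖x‖}` for `y ∈ B` ⇒
  `‖F(x+iy)‖ ≤ C (2 / cos 1)^{Mk} e^{(ckM)‖x‖}` for `y ∈ conv B`, with `c = 1/(R+1)`,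
  `M = ⌈a(R+1)⌉`, `R ≥ ‖conv B‖`.
* `norm_le_explicit_of_polyGrowth_argRegion` — in the variables `ζᵢ = e^{wᵢ}`:
  `‖f ζ‖ ≤ C (∏(|ζᵢ|+|ζᵢ|⁻¹))^p` on the argument region of `B ⊆ (-π/2, π/2)ᵏ` ⇒
  `‖f ζ‖ ≤ C · 2^{kp} (2 / cos 1)^{pk(2k+1)k} (∏(|ζᵢ|+|ζᵢ|⁻¹))^{pk²}` on the region of `conv B`.

## References

* K. Osterwalder, R. Schrader, *Axioms for Euclidean Green's functions II*, Comm. Math. Phys. 42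
  (1975) 281–305, Ch. V.2 p. 294; Ch. VI (6.15). [OsterwalderSchraderCMP1975]
-/

noncomputable section

open _root_.Complex Set Filter Metric Real
open scoped _root_.Topology

namespace Literature.Analysis.Complex

open TubeFourier

variable {k : ℕ}

/-! ### The sharp maximum principle for functions on the hull -/

/-- **Sharp maximum principle on tubes, for a function holomorphic on the hull** (OS II (6.15)):
`B` open, star-shaped with respect to `0 ∈ B`; `F` holomorphic on `T(conv B)` with `‖F‖ ≤ M` on
`T(B)`; then `‖F‖ ≤ M` on `T(conv B)`. [cite: OsterwalderSchraderCMP1975, Ch. VI (6.15)] -/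
theorem norm_le_on_tube_convexHull_of_norm_le {B : Set (EuclideanSpace ℝ (Fin k))} (hBo : IsOpen B)
    (h0 : (0 : EuclideanSpace ℝ (Fin k)) ∈ B) (hst : StarConvex ℝ 0 B) {F : (Fin k → ℂ) → ℂ}
    (hF : DifferentiableOn ℂ F (tube (convexHull ℝ B))) {M : ℝ} (hM : ∀ z ∈ tube B, ‖F z‖ ≤ M)
    {z : Fin k → ℂ} (hz : z ∈ tube (convexHull ℝ B)) : ‖F z‖ ≤ M := by
  have hFB : DifferentiableOn ℂ F (tube B) := hF.mono (tube_mono (subset_convexHull ℝ B))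
  obtain ⟨G, hGd, -, hGb, hGu⟩ := exists_holomorphic_extension_tube_convexHull_of_bound hBo h0 hst hFB hM
  rw [hGu F hF (fun _ _ => rfl) hz]
  exact hGb z hz

/-! ### The damping factor -/

/-- **Lower bound for the damping factor**: for `|c yᵢ| ≤ 1`,
`(cos 1 / 2)^{Mk} e^{cM‖x‖} ≤ ‖∏ᵢ cosh(c (xᵢ + i yᵢ))^M‖`. [folklore] -/
theorem norm_cosh_prod_ge {c : ℝ} (hc : 0 < c) (M : ℕ) (x y : EuclideanSpace ℝ (Fin k))
    (hy : ∀ i, |c * y i| ≤ 1) :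
    (Real.cos 1 / 2) ^ (M * k) * Real.exp (c * M * ‖x‖) ≤
      ‖∏ i, Complex.cosh (c * cpt x y i) ^ M‖ := by
  have hccpt : ∀ i : Fin k, (c : ℂ) * cpt x y i = ((c * x i : ℝ) : ℂ) + ((c * y i : ℝ) : ℂ) * I := by
    intro i; simp only [cpt_apply]; push_cast; ring
  have hfac : ∀ i, (Real.cos 1 / 2) ^ M * Real.exp (c * M * |x i|) ≤
      ‖Complex.cosh (c * cpt x y i) ^ M‖ := by
    intro i
    rw [norm_pow, hccpt, show c * M * |x i| = (M : ℝ) * |c * x i| by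
      rw [abs_mul, abs_of_pos hc]; ring, Real.exp_nat_mul, ← mul_pow]
    exact pow_le_pow_left₀ (by have := Real.cos_one_pos; positivity)
      (cos_one_half_exp_le_norm_cosh (hy i)) M
  have hprod : ∏ i, (Real.cos 1 / 2) ^ M * Real.exp (c * M * |x i|) ≤
      ‖∏ i, Complex.cosh (c * cpt x y i) ^ M‖ := by
    rw [norm_prod]
    exact Finset.prod_le_prod (fun i _ => by have := Real.cos_one_pos; positivity) fun i _ => hfac i
  refine le_trans ?_ hprod
  rw [Finset.prod_mul_distrib, Finset.prod_const, Finset.card_univ, Fintype.card_fin, ← pow_mul,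
    ← Real.exp_sum, ← Finset.mul_sum]
  have hcM : 0 ≤ c * M := mul_nonneg hc.le (Nat.cast_nonneg M)
  exact mul_le_mul_of_nonneg_left (Real.exp_le_exp.2 (mul_le_mul_of_nonneg_left
    (norm_le_sum_abs_euclidean x) hcM)) (by have := Real.cos_one_pos; positivity)

/-- **Upper bound for the damping factor**: `‖∏ᵢ cosh(c (xᵢ + i yᵢ))^M‖ ≤ e^{cMk‖x‖}`. [folklore] -/
theorem norm_cosh_prod_le {c : ℝ} (hc : 0 < c) (M : ℕ) (x y : EuclideanSpace ℝ (Fin k)) :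
    ‖∏ i, Complex.cosh (c * cpt x y i) ^ M‖ ≤ Real.exp (c * M * k * ‖x‖) := by
  have hccpt : ∀ i : Fin k, (c : ℂ) * cpt x y i = ((c * x i : ℝ) : ℂ) + ((c * y i : ℝ) : ℂ) * I := by
    intro i; simp only [cpt_apply]; push_cast; ring
  have hfac : ∀ i, ‖Complex.cosh (c * cpt x y i) ^ M‖ ≤ Real.exp (c * ‖x‖) ^ M := by
    intro i
    rw [norm_pow]
    refine pow_le_pow_left₀ (norm_nonneg _) ((norm_cosh_le_exp_abs_re _).trans ?_) M
    rw [hccpt]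
    simp only [Complex.add_re, Complex.ofReal_re, Complex.mul_re, Complex.I_re, Complex.I_im,
      Complex.ofReal_im, mul_zero, zero_mul, sub_zero, add_zero]
    rw [abs_mul, abs_of_pos hc]
    exact Real.exp_le_exp.2 (mul_le_mul_of_nonneg_left (abs_apply_le_norm_euclidean x i) hc.le)
  calc ‖∏ i, Complex.cosh (c * cpt x y i) ^ M‖ = ∏ i, ‖Complex.cosh (c * cpt x y i) ^ M‖ := norm_prod _ _
    _ ≤ ∏ _i : Fin k, Real.exp (c * ‖x‖) ^ M := Finset.prod_le_prod (fun i _ => norm_nonneg _) fun i _ => hfac i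
    _ = Real.exp (c * M * k * ‖x‖) := by
        rw [Finset.prod_const, Finset.card_univ, Fintype.card_fin, ← pow_mul, ← Real.exp_nat_mul]
        congr 1; push_cast; ring

/-! ### Explicit exponential bounds on the hull -/

/-- **Explicit bound on the hull under exponential growth on `T(B)`.** Let `B` be open and
star-shaped with respect to `0 ∈ B`, `‖y‖ ≤ R` on `conv B`, and `F` holomorphic on `T(conv B)` with
`‖F(x + iy)‖ ≤ C e^{a‖x‖}` for `y ∈ B` (`a ≥ 0`). Then for `y ∈ conv B`,
`‖F(x + iy)‖ ≤ C (2 / cos 1)^{Mk} e^{(M k/(R+1))‖x‖}` with `M = ⌈a (R+1)⌉₊` — a bound depending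
on `F` only through `(C, a)`. [folklore] -/
theorem norm_le_explicit_of_expGrowth {B : Set (EuclideanSpace ℝ (Fin k))} (hBo : IsOpen B)
    (h0 : (0 : EuclideanSpace ℝ (Fin k)) ∈ B) (hst : StarConvex ℝ 0 B) {R : ℝ} (hR0 : 0 ≤ R)
    (hR : ∀ y ∈ convexHull ℝ B, ‖y‖ ≤ R) {F : (Fin k → ℂ) → ℂ}
    (hF : DifferentiableOn ℂ F (tube (convexHull ℝ B))) {C a : ℝ}
    (hgr : ∀ x, ∀ y ∈ B, ‖F (cpt x y)‖ ≤ C * Real.exp (a * ‖x‖))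
    (x : EuclideanSpace ℝ (Fin k)) {y : EuclideanSpace ℝ (Fin k)} (hy : y ∈ convexHull ℝ B) :
    ‖F (cpt x y)‖ ≤ C * (2 / Real.cos 1) ^ (⌈a * (R + 1)⌉₊ * k) *
      Real.exp ((⌈a * (R + 1)⌉₊ : ℝ) * k / (R + 1) * ‖x‖) := by
  classical
  set M : ℕ := ⌈a * (R + 1)⌉₊ with hM
  set c : ℝ := 1 / (R + 1) with hc
  have hR1 : 0 < R + 1 := by linarith
  have hc0 : 0 < c := by rw [hc]; positivity
  have hcy : ∀ y ∈ convexHull ℝ B, ∀ i, |c * y i| ≤ 1 := by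
    intro y hy i
    rw [abs_mul, abs_of_pos hc0]
    have h1 : |y i| ≤ R + 1 := (abs_apply_le_norm_euclidean y i).trans ((hR y hy).trans (by linarith))
    calc c * |y i| ≤ c * (R + 1) := by gcongr
      _ = 1 := by rw [hc]; field_simp
  have hcM : a ≤ c * M := by
    have h1 : a * (R + 1) ≤ M := Nat.le_ceil _
    rw [hc, div_mul_eq_mul_div, one_mul, le_div_iff₀ hR1]; exact h1
  -- the damping factor and the damped function
  set E : (Fin k → ℂ) → ℂ := fun w => ∏ i, Complex.cosh (c * w i) ^ M with hE
  have hEd : Differentiable ℂ E := fun w =>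
    (HasFDerivAt.finsetProd (u := Finset.univ) (fun i _ =>
      (((Complex.differentiable_cosh.comp ((differentiable_apply i).const_mul (c : ℂ))).pow M) w).hasFDerivAt)).differentiableAt
  set A : ℝ := (Real.cos 1 / 2) ^ (M * k) with hA
  have hA0 : 0 < A := by have := Real.cos_one_pos; positivity
  have hElow : ∀ x', ∀ y' ∈ convexHull ℝ B, A * Real.exp (c * M * ‖x'‖) ≤ ‖E (cpt x' y')‖ := fun x' y' hy' =>
    norm_cosh_prod_ge hc0 M x' y' (hcy y' hy')
  have hE0 : ∀ w ∈ tube (convexHull ℝ B), E w ≠ 0 := by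
    intro w hw h
    have h1 := hElow (rev w) (imv w) hw
    rw [cpt_rev_imv, h, norm_zero] at h1
    have : 0 < A * Real.exp (c * M * ‖rev w‖) := by positivity
    linarith
  set G : (Fin k → ℂ) → ℂ := fun w => F w * (E w)⁻¹ with hG
  have hGd : DifferentiableOn ℂ G (tube (convexHull ℝ B)) := hF.mul (hEd.differentiableOn.inv hE0)
  -- `‖G‖ ≤ max C 0 / A` on `T(B)`
  have hGb : ∀ w ∈ tube B, ‖G w‖ ≤ max C 0 / A := by
    intro w hw
    have hyB : imv w ∈ B := hw
    have hyc : imv w ∈ convexHull ℝ B := subset_convexHull ℝ B hyB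
    have hEpos : 0 < ‖E w‖ := by
      have := hElow (rev w) (imv w) hyc; rw [cpt_rev_imv] at this
      exact lt_of_lt_of_le (by positivity) this
    rw [hG, norm_mul, norm_inv, ← div_eq_mul_inv, div_le_iff₀ hEpos]
    have h1 := hgr (rev w) (imv w) hyB
    rw [cpt_rev_imv] at h1
    have h2 := hElow (rev w) (imv w) hyc
    rw [cpt_rev_imv] at h2
    calc ‖F w‖ ≤ C * Real.exp (a * ‖rev w‖) := h1
      _ ≤ max C 0 * Real.exp (c * M * ‖rev w‖) := by
          refine le_trans (mul_le_mul_of_nonneg_right (le_max_left C 0) (Real.exp_pos _).le) ?_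
          exact mul_le_mul_of_nonneg_left (Real.exp_le_exp.2
            (mul_le_mul_of_nonneg_right hcM (norm_nonneg _))) (le_max_right C 0)
      _ = max C 0 / A * (A * Real.exp (c * M * ‖rev w‖)) := by field_simp
      _ ≤ max C 0 / A * ‖E w‖ := mul_le_mul_of_nonneg_left h2 (by positivity)
  -- the sharp maximum principle for `G`
  have hz : cpt x y ∈ tube (convexHull ℝ B) := by rw [mem_tube, imv_cpt]; exact hy
  have hGz := norm_le_on_tube_convexHull_of_norm_le hBo h0 hst hGd hGb hz
  -- back to `F`
  have hFG : F (cpt x y) = G (cpt x y) * E (cpt x y) := by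
    rw [hG]; exact (inv_mul_cancel_right₀ (hE0 _ hz) _).symm
  rw [hFG, norm_mul]
  have hEup := norm_cosh_prod_le hc0 M x y
  calc ‖G (cpt x y)‖ * ‖E (cpt x y)‖ ≤ max C 0 / A * Real.exp (c * M * k * ‖x‖) :=
        mul_le_mul hGz hEup (norm_nonneg _) (by positivity)
    _ ≤ C * (2 / Real.cos 1) ^ (M * k) * Real.exp ((M : ℝ) * k / (R + 1) * ‖x‖) := by
        have hc1 : 0 < Real.cos 1 := Real.cos_one_pos
        have hAinv : (1 : ℝ) / A = (2 / Real.cos 1) ^ (M * k) := by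
          rw [hA, one_div, ← inv_pow, inv_div]
        have hexp : c * M * k * ‖x‖ = (M : ℝ) * k / (R + 1) * ‖x‖ := by rw [hc]; ring
        rw [hexp]
        refine mul_le_mul_of_nonneg_right ?_ (Real.exp_pos _).le
        rw [div_eq_mul_one_div, hAinv]
        rcases le_or_gt 0 C with hC | hC
        · rw [max_eq_left hC]
        · -- `C < 0`: the hypothesis forces `B = ∅`-like vacuity; still `max C 0 = 0 ≤ …` fails,
          -- so use that the bound with `C < 0` is impossible at `y = 0 ∈ B`
          exfalso
          have := hgr x 0 h0
          have : (0 : ℝ) ≤ C * Real.exp (a * ‖x‖) := (norm_nonneg _).trans this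
          nlinarith [Real.exp_pos (a * ‖x‖)]

/-! ### Explicit polynomial bounds on argument regions -/

/-- **Explicit bound on the argument region of the hull** (family-uniform form of the growth
conclusion of `exists_holomorphic_extension_argRegion_convexHull`): `B ⊆ (-π/2, π/2)ᵏ` open and
star-shaped with respect to `0 ∈ B`, `f` holomorphic on `{Re ζᵢ > 0, (arg ζᵢ)ᵢ ∈ conv B}` with
`‖f ζ‖ ≤ C (∏ᵢ (‖ζᵢ‖ + ‖ζᵢ‖⁻¹))^p` on the region of `B`; then on the region of `conv B`,
`‖f ζ‖ ≤ C 2^{kp} (2 / cos 1)^{pk(2k+1)k} (∏ᵢ (‖ζᵢ‖ + ‖ζᵢ‖⁻¹))^{pk²}`. [cite: OsterwalderSchraderCMP1975, Ch. VI (6.15)] -/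
theorem norm_le_explicit_of_polyGrowth_argRegion {B : Set (Fin k → ℝ)} (hBo : IsOpen B)
    (h0 : (0 : Fin k → ℝ) ∈ B) (hst : StarConvex ℝ 0 B) (hB : B ⊆ {v | ∀ i, |v i| < π / 2})
    {f : (Fin k → ℂ) → ℂ}
    (hf : DifferentiableOn ℂ f {ζ | (∀ i, 0 < (ζ i).re) ∧ (fun i => (ζ i).arg) ∈ convexHull ℝ B})
    {C : ℝ} {p : ℕ}
    (hgr : ∀ ζ : Fin k → ℂ, (∀ i, 0 < (ζ i).re) → (fun i => (ζ i).arg) ∈ B →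
      ‖f ζ‖ ≤ C * (∏ i, (‖ζ i‖ + ‖ζ i‖⁻¹)) ^ p)
    {ζ : Fin k → ℂ} (hζ : ∀ i, 0 < (ζ i).re) (hζB : (fun i => (ζ i).arg) ∈ convexHull ℝ B) :
    ‖f ζ‖ ≤ C * (2 : ℝ) ^ (k * p) * (2 / Real.cos 1) ^ (p * k * (2 * k + 1) * k) *
      (∏ i, (‖ζ i‖ + ‖ζ i‖⁻¹)) ^ (p * k * k) := by
  classical
  have hcubec : Convex ℝ {v : Fin k → ℝ | ∀ i, |v i| < π / 2} := convex_setOf_forall_abs_lt _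
  have hHB : convexHull ℝ B ⊆ {v : Fin k → ℝ | ∀ i, |v i| < π / 2} := convexHull_min hB hcubec
  have hBsubH : B ⊆ convexHull ℝ B := subset_convexHull ℝ B
  -- `C ≥ 0`, from the hypothesis at the positive real point `1`
  have hC0 : 0 ≤ C := by
    have h1 := hgr (fun _ => (1 : ℂ)) (fun _ => by simp) (by
      rw [show (fun _ : Fin k => ((1 : ℂ)).arg) = 0 from funext fun _ => by simp]; exact h0)
    simp only [norm_one, inv_one] at h1
    have h2 : (0 : ℝ) < (∏ _i : Fin k, ((1 : ℝ) + 1)) ^ p := by positivity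
    nlinarith [norm_nonneg (f fun _ => (1 : ℂ))]
  -- Euclidean coordinates
  set e : EuclideanSpace ℝ (Fin k) ≃L[ℝ] (Fin k → ℝ) := EuclideanSpace.equiv (Fin k) ℝ with he
  have he_apply : ∀ (y : EuclideanSpace ℝ (Fin k)) (j : Fin k), e y j = y j := fun y j => rfl
  set B' : Set (EuclideanSpace ℝ (Fin k)) := e ⁻¹' B with hB'
  have hB'o : IsOpen B' := hBo.preimage e.continuous
  have h0' : (0 : EuclideanSpace ℝ (Fin k)) ∈ B' := by
    show e 0 ∈ B; rw [map_zero]; exact h0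
  have hst' : StarConvex ℝ (0 : EuclideanSpace ℝ (Fin k)) B' := by
    have := StarConvex.linear_preimage (s := B) (e : EuclideanSpace ℝ (Fin k) →ₗ[ℝ] (Fin k → ℝ))
      (by rw [show ((e : EuclideanSpace ℝ (Fin k) →ₗ[ℝ] (Fin k → ℝ)) 0) = 0 from map_zero _]; exact hst)
    exact this
  have hconv : convexHull ℝ B' = e ⁻¹' convexHull ℝ B := by
    rw [hB', ← ContinuousLinearEquiv.image_symm_eq_preimage,
      ← ContinuousLinearEquiv.image_symm_eq_preimage]
    exact (LinearMap.image_convexHull (e.symm : (Fin k → ℝ) →ₗ[ℝ] EuclideanSpace ℝ (Fin k)) B).symm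
  have hmem_tube : ∀ (S : Set (Fin k → ℝ)) (w : Fin k → ℂ),
      w ∈ tube (e ⁻¹' S) ↔ (fun j => (w j).im) ∈ S := by
    intro S w
    rw [mem_tube, Set.mem_preimage]
    exact Iff.of_eq (congrArg (· ∈ S) (funext fun j => by rw [he_apply, imv_apply]))
  -- radius of the hull: `‖y‖ ≤ ∑ |yⱼ| ≤ k π/2 ≤ 2k`
  have hR : ∀ y ∈ convexHull ℝ B', ‖y‖ ≤ 2 * k := by
    intro y hy
    rw [hconv] at hy
    have hy' : ∀ j, |y j| < π / 2 := hHB hy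
    calc ‖y‖ ≤ ∑ j, |y j| := norm_le_sum_abs_euclidean y
      _ ≤ ∑ _j : Fin k, (2 : ℝ) := Finset.sum_le_sum fun j _ => by
          have := hy' j; linarith [Real.pi_le_four]
      _ = 2 * k := by simp [mul_comm]
  -- exp and the function in tube coordinates
  have hexp : ∀ w : Fin k → ℂ, (fun j => (w j).im) ∈ convexHull ℝ B →
      (∀ j, 0 < (Complex.exp (w j)).re) ∧ (fun j => (Complex.exp (w j)).arg) = fun j => (w j).im := by
    intro w hw
    have h := fun j => re_exp_pos_and_arg_exp (hHB hw j)
    exact ⟨fun j => (h j).1, funext fun j => (h j).2⟩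
  have hexp_d : Differentiable ℂ fun w : Fin k → ℂ => (fun j => Complex.exp (w j)) :=
    differentiable_pi.2 fun j => Complex.differentiable_exp.comp (differentiable_apply (𝕜 := ℂ) j)
  set g : (Fin k → ℂ) → ℂ := fun w => f fun j => Complex.exp (w j) with hg
  have hgd : DifferentiableOn ℂ g (tube (convexHull ℝ B')) := by
    refine hf.comp hexp_d.differentiableOn fun w hw => ?_
    rw [hconv, hmem_tube] at hw
    obtain ⟨hre, harg⟩ := hexp w hw
    exact ⟨hre, by rw [harg]; exact hw⟩
  -- exponential growth of `g` on `T(B')` with explicit constants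
  have hggr : ∀ x', ∀ y' ∈ B', ‖g (cpt x' y')‖ ≤ C * (2 : ℝ) ^ (k * p) * Real.exp ((p * k : ℕ) * ‖x'‖) := by
    intro x' y' hy'
    have hyB : (fun j => (cpt x' y' j).im) ∈ B := by
      have : (fun j => (cpt x' y' j).im) = e y' := funext fun j => by simp [he_apply]
      rw [this]; exact hy'
    obtain ⟨hre, harg⟩ := hexp (cpt x' y') (hBsubH hyB)
    have h1 := hgr _ hre (by rw [harg]; exact hyB)
    have hprod : (∏ j, (‖Complex.exp (cpt x' y' j)‖ + ‖Complex.exp (cpt x' y' j)‖⁻¹)) ≤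
        (2 : ℝ) ^ k * Real.exp (k * ‖x'‖) := by
      have hfac : ∀ j, ‖Complex.exp (cpt x' y' j)‖ + ‖Complex.exp (cpt x' y' j)‖⁻¹ ≤ 2 * Real.exp ‖x'‖ := by
        intro j
        rw [Complex.norm_exp, ← Real.exp_neg]
        simp only [cpt_apply, Complex.add_re, Complex.ofReal_re, Complex.mul_re, Complex.I_re,
          Complex.I_im, Complex.ofReal_im, mul_zero, zero_mul, sub_zero, add_zero]
        refine (exp_add_exp_neg_le (x' j)).trans ?_
        gcongr
        exact abs_apply_le_norm_euclidean x' j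
      calc (∏ j, (‖Complex.exp (cpt x' y' j)‖ + ‖Complex.exp (cpt x' y' j)‖⁻¹))
          ≤ ∏ _j : Fin k, 2 * Real.exp ‖x'‖ :=
            Finset.prod_le_prod (fun j _ => by positivity) fun j _ => hfac j
        _ = (2 : ℝ) ^ k * Real.exp (k * ‖x'‖) := by
            rw [Finset.prod_const, Finset.card_univ, Fintype.card_fin, mul_pow, ← Real.exp_nat_mul]
    calc ‖g (cpt x' y')‖ = ‖f fun j => Complex.exp (cpt x' y' j)‖ := rfl
      _ ≤ C * (∏ j, (‖Complex.exp (cpt x' y' j)‖ + ‖Complex.exp (cpt x' y' j)‖⁻¹)) ^ p := h1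
      _ ≤ C * ((2 : ℝ) ^ k * Real.exp (k * ‖x'‖)) ^ p :=
          mul_le_mul_of_nonneg_left (pow_le_pow_left₀ (by positivity) hprod p) hC0
      _ = C * (2 : ℝ) ^ (k * p) * Real.exp ((p * k : ℕ) * ‖x'‖) := by
          rw [mul_pow, ← pow_mul, ← Real.exp_nat_mul]; push_cast; ring
  -- the explicit tube bound
  set x : EuclideanSpace ℝ (Fin k) := e.symm fun j => Real.log ‖ζ j‖ with hx
  set y : EuclideanSpace ℝ (Fin k) := e.symm fun j => (ζ j).arg with hy
  have hxj : ∀ j, x j = Real.log ‖ζ j‖ := fun j => by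
    rw [← he_apply, hx, ContinuousLinearEquiv.apply_symm_apply]
  have hyj : ∀ j, y j = (ζ j).arg := fun j => by
    rw [← he_apply, hy, ContinuousLinearEquiv.apply_symm_apply]
  have hcpt : cpt x y = fun j => Complex.log (ζ j) := by
    funext j
    apply Complex.ext
    · simp [cpt_apply, hxj, Complex.log_re]
    · simp [cpt_apply, hyj, Complex.log_im]
  have hyH : y ∈ convexHull ℝ B' := by
    rw [hconv]; show e y ∈ convexHull ℝ B
    have : e y = fun j => (ζ j).arg := funext fun j => by rw [he_apply, hyj]
    rw [this]; exact hζB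
  have hζ0 : ∀ j, ζ j ≠ 0 := fun j h => by have := hζ j; rw [h] at this; simp at this
  have hfg : f ζ = g (cpt x y) := by
    rw [hcpt, hg]; simp only
    congr 1; exact (funext fun j => Complex.exp_log (hζ0 j)).symm
  have hk0 : (0 : ℝ) ≤ 2 * k := by positivity
  have hmain := norm_le_explicit_of_expGrowth hB'o h0' hst' hk0 hR hgd hggr x hyH
  rw [hfg]
  -- simplify the ceiling: `⌈pk(2k+1)⌉ = pk(2k+1)`
  have hceil : ⌈((p * k : ℕ) : ℝ) * (2 * k + 1)⌉₊ = p * k * (2 * k + 1) := by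
    have : ((p * k : ℕ) : ℝ) * (2 * k + 1) = ((p * k * (2 * k + 1) : ℕ) : ℝ) := by push_cast; ring
    rw [this, Nat.ceil_natCast]
  rw [hceil] at hmain
  refine hmain.trans ?_
  -- compare the exponential factor with the product
  have hexp_le : Real.exp (((p * k * (2 * k + 1) : ℕ) : ℝ) * k / (2 * k + 1) * ‖x‖) ≤
      (∏ j, (‖ζ j‖ + ‖ζ j‖⁻¹)) ^ (p * k * k) := by
    have hcoef : ((p * k * (2 * k + 1) : ℕ) : ℝ) * k / (2 * k + 1) = ((p * k * k : ℕ) : ℝ) := by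
      have : (2 * (k : ℝ) + 1) ≠ 0 := by positivity
      field_simp
      push_cast
      ring
    rw [hcoef]
    calc Real.exp (((p * k * k : ℕ) : ℝ) * ‖x‖) ≤ Real.exp (((p * k * k : ℕ) : ℝ) * ∑ j, |x j|) := by
          refine Real.exp_le_exp.2 (mul_le_mul_of_nonneg_left (norm_le_sum_abs_euclidean x) (by positivity))
      _ = ∏ j, Real.exp |x j| ^ (p * k * k) := by
          rw [Finset.mul_sum, Real.exp_sum]
          refine Finset.prod_congr rfl fun j _ => ?_
          rw [← Real.exp_nat_mul]
      _ ≤ ∏ j, (‖ζ j‖ + ‖ζ j‖⁻¹) ^ (p * k * k) := by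
          refine Finset.prod_le_prod (fun j _ => by positivity) fun j _ => ?_
          refine pow_le_pow_left₀ (Real.exp_pos _).le ?_ _
          rw [hxj]
          exact exp_abs_log_le (norm_pos_iff.2 (hζ0 j))
      _ = (∏ j, (‖ζ j‖ + ‖ζ j‖⁻¹)) ^ (p * k * k) := Finset.prod_pow _ _ _
  have hC0' : 0 ≤ C * (2 : ℝ) ^ (k * p) * (2 / Real.cos 1) ^ (p * k * (2 * k + 1) * k) := by
    have hc1 : 0 < Real.cos 1 := Real.cos_one_pos
    positivity
  exact mul_le_mul_of_nonneg_left hexp_le hC0'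

end Literature.Analysis.Complex
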